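import Summits.Ventures.CertifiedQuantumChemistry.Rows.MPSUpperBound
import HarnessLib

/-!
# Ventures/CertifiedQuantumChemistry — Rows/MPOAutomaton.lean: the exact QC-MPO's AUTOMATON is sound — a prefix /
# complementary-suffix MPO assembled over a term list represents `Σ_t c_t ⨂_j w^t_j` (FORMAT-qcmps0 §3: every `k`,
# every term list, every switch policy), which discharges the operator hypothesis `hO` of `Rows/MPSUpperBound.lean`
# to per-edge structure of the emitted tensors

HONEST FRAMING (verbatim): certified bounds for a stated model Hamiltonian in a stated basis; not a
claim about the real molecule beyond that model.

var-2 (gen 11), zero compute, PROVED glue only (0 sorry, no definition, no claim node; nothing here asserts a bound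
about any model). `Rows/MPSUpperBound.lean` turns an MPS state file, an MPO and the enclosures of two sweeps into the
typer's `UpperCertificate` / `UpperRow` under ONE global operator hypothesis `hO` — "the MPO's word products are the
configuration matrix elements of `H_F`", FORMAT-qcmps0 §3's sentence "by induction the contraction is
`Σ_t c_t ⊗_j w^t_j = H_F`" — so far checked outside the kernel only (dense expansion = brute-force CAR matrix for
`k ≤ 4`, `tests/test_mpo.py`; the MPO-independent lineage B′ for `k ≤ 12`). `Rows/JordanWignerWords.lean` reduced it
to bookkeeping (an MPO is the sum over its bond-state paths of the product operators of the edge letters; `H_F` is a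
finite sum coefficient • word). This file proves that induction for the construction SCHEME of `qcmps.mpo.build_mpo`
— prefix ("trie", `T(w[:b])`) and complementary-suffix ("co-trie", `C(w[b:])`) states, shared `T→T` / `C→C` edges,
one accumulating `T→C` switch edge per term — for every number of sites and every switch policy:

* §Slot — `⨂` is linear in each letter (`productOp_update_apply`, `productOp_update_sum_smul`) and vanishes with a
  zero letter (`productOp_eq_zero_of_apply_eq_zero`). [folklore]
* §Automaton — **`sum_paths_productOp_eq_sum_terms`**: each term `t` has a STATE PATH `σ t` (START … END) and a
  SWITCH SITE `sw t`; if (i) off its switch site the edge a term traverses carries the term's letter (`build_mpo`: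
  assigned edges "must agree if present"), (ii) equal paths switch at the same site, (iii) the switch edge carries
  `Σ_{t' : σ t' = σ t} c_{t'} w^{t'}_{sw t}` (`build_mpo`: the `T→C` edge "accumulates `c_t·w^t_b`"), and (iv) every
  other START→END path meets a zero letter, then `Σ_paths ⨂(edge letters) = Σ_t c_t ⨂_j w^t_j` (fibrewise over
  paths, one-slot linearity at the switch site). **`exists_letter_eq_zero_of_trie`** derives (iv) — and
  `sw_eq_of_path_eq_of_trie` (ii) — from the SHAPE of §3's state labels alone, for any letter type: no bond state is
  before the switch for one term and after it for another (`hdisj`: `T`- and `C`-states are distinct), and every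
  non-zero edge is a trie edge (every term in its target comes from its source: a prefix has one parent), a co-trie
  edge (every term in its source proceeds to its target: a suffix has one child) or some term's switch edge
  (`hedges`) — induction forward along the trie part and backward along the co-trie part of an arbitrary accepting
  path, which its switch edge then identifies with a term's own path. **`of_wordProducts_eq_sum_terms_of_trie`**: the
  word-product operator of such an MPO IS `Σ_t c_t ⨂_j w^t_j` (letters in `ℂ^{q×q}`, so also for the Hubbard MPOs).
* §Represents — **`toSpin_eq_wordProducts_of_trie`**: for `H` presented by a real term list
  (`toSpin H = Σ_t c_t • ⨂_i w^t_i`, real `c_t`, real `4 × 4` letters) and a real MPO so organised (`k ≥ 1`), the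
  conclusion is LITERALLY the hypothesis `hO` of `Rows/MPSUpperBound.lean`; END FORM
  **`upperRow_of_mps_trie_charges_sweeps`** = `upperRow_of_mps_charges_sweeps` with `hO` replaced by the term-list
  presentation `hH` and the per-edge facts `hshared` / `hswitch` / `hdisj` / `hedges`.

What is NOT claimed: no instance is verified here. For a given file the facts that remain are (a) that the builder's
term list (merged equal words, letter signs moved into `c_t` by `canonical_word`, orbitals in `site_perm` order)
presents `H_F` — the raw list is `toSpin_molecularHamiltonian_eq_sum_productOp`; merging is `add_smul`, a sign move is
one-slot linearity — and (b) that the emitted tensors have the stated shape over that list (what `build_mpo` asserts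
while assembling: assigned edges agree, every term switches exactly once, accumulating edges never alias assigned
ones); both stay instance data with the readers (`tests/test_mpo.py`, lineages A1 / B2 / B3 / B′), as for every
certificate class of the cell. No floating-point statement; no row; nothing is instantiated. References: FORMAT-qcmps0
§3 (HOME `pub-qchem-var2/`); qcmps `mpo.py` (`build_mpo`, `BUILDER_VERSION` 0.5.0); G. M. Crosswhite, D. Bacon, Phys.
Rev. A 78 (2008) 012356 and U. Schollwöck, Ann. Phys. 326 (2011) 96, §6.1 (MPOs as finite-state automata); S. Keller,
M. Dolfi, M. Troyer, M. Reiher, J. Chem. Phys. 143 (2015) 244118, §II and G. K.-L. Chan, A. Keselman, N. Nakatani,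
Z. Li, S. R. White, J. Chem. Phys. 145 (2016) 014102, §II (operator strings, prefix sharing, complementary operators).
-/

noncomputable section

namespace Summit.Ventures.CertifiedQuantumChemistry

open Matrix Finset
open Literature.MathematicalPhysics.QuantumLattice
open Literature.MathematicalPhysics.QuantumLattice.JordanWigner
open Literature.MathematicalPhysics.QuantumChemistry

/-! ## A product operator is linear in each letter -/

section Slot

variable {Λ : Type*} [Fintype Λ] [DecidableEq Λ] {q : ℕ}

/-- Entries of a product operator with the letter at one site replaced: the replaced letter's entry times the
product of the other sites' entries. [folklore] -/
theorem productOp_update_apply (u : Λ → Matrix (Fin q) (Fin q) ℂ) (x : Λ) (a : Matrix (Fin q) (Fin q) ℂ)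
    (σ τ : TensorIndex Λ q) :
    productOp (Function.update u x a) σ τ = a (σ x) (τ x) * ∏ y ∈ univ.erase x, u y (σ y) (τ y) := by
  rw [productOp_apply, ← Finset.mul_prod_erase univ _ (mem_univ x), Function.update_self]
  congr 1
  exact Finset.prod_congr rfl fun y hy => by rw [Function.update_of_ne (ne_of_mem_erase hy)]

omit [DecidableEq Λ] in
/-- A product operator with a zero letter is zero. [folklore] -/
theorem productOp_eq_zero_of_apply_eq_zero {u : Λ → Matrix (Fin q) (Fin q) ℂ} {x : Λ} (hx : u x = 0) :
    productOp u = 0 := by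
  ext σ τ
  rw [productOp_apply, Matrix.zero_apply]
  exact Finset.prod_eq_zero (mem_univ x) (by rw [hx, Matrix.zero_apply])

/-- **Linearity in one letter**: `⨂ (…, Σ_i c_i a_i, …) = Σ_i c_i ⨂ (…, a_i, …)`. [folklore] -/
theorem productOp_update_sum_smul {ι : Type*} (s : Finset ι) (c : ι → ℂ) (a : ι → Matrix (Fin q) (Fin q) ℂ)
    (u : Λ → Matrix (Fin q) (Fin q) ℂ) (x : Λ) :
    productOp (Function.update u x (∑ i ∈ s, c i • a i)) =
      ∑ i ∈ s, c i • productOp (Function.update u x (a i)) := by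
  ext σ τ
  rw [productOp_update_apply, Matrix.sum_apply, Matrix.sum_apply, Finset.sum_mul]
  refine Finset.sum_congr rfl fun i _ => ?_
  rw [Matrix.smul_apply, Matrix.smul_apply, productOp_update_apply, smul_eq_mul, smul_eq_mul, mul_assoc]

end Slot

/-! ## The term automaton: accepting paths carry the terms -/

section Automaton

variable {m : Type*} [Fintype m] [DecidableEq m] {T : Type*} [Fintype T] {N q : ℕ}

/-- **Soundness of the term automaton (FORMAT-qcmps0 §3, "by induction the contraction is `Σ_t c_t ⊗_j w^t_j`").**
On the chain `Fin N` with one bond-state type `m`, edge letters `W i x y` (site `i`, bond states `x → y`), START `x₀`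
and END `y₀`, let a finite term list be given: coefficients `c t`, words `w t : Fin N → letters`, and for every term
its STATE PATH `σ t : Fin (N+1) → m` from `x₀` to `y₀` and its SWITCH SITE `sw t` (the unique `T → C` edge of §3).
If (i) off its switch site the edge a term traverses carries exactly the term's letter ("`T→T` and `C→C` edges carry
the shared letter, assigned once"), (ii) terms with the same path switch at the same site, (iii) the switch edge of a
term carries the accumulated `Σ c_{t'} w^{t'}` over the terms `t'` with the SAME path ("the `T→C` edge of a term
accumulates `c_t·w^t_b`"), and (iv) every other path from `x₀` to `y₀` meets a zero letter (no other accepting path),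
then the sum over all bond-state paths of the product operators of the edge letters — which IS the operator the MPO's
word products define (`of_ofFn_prod_apply_eq_sum_paths_productOp`, `Rows/JordanWignerWords.lean`) — equals
`Σ_t c_t ⨂_i w^t_i`. Pure bookkeeping + linearity of `⨂` in one letter; every `N`, every bond dimension. -/
theorem sum_paths_productOp_eq_sum_terms (W : Fin N → m → m → Matrix (Fin q) (Fin q) ℂ) (x₀ y₀ : m)
    (c : T → ℂ) (w : T → Fin N → Matrix (Fin q) (Fin q) ℂ) (σ : T → Fin (N + 1) → m) (sw : T → Fin N)
    (hends : ∀ t, σ t 0 = x₀ ∧ σ t (Fin.last N) = y₀)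
    (hshared : ∀ t (i : Fin N), i ≠ sw t → W i (σ t (Fin.castSucc i)) (σ t i.succ) = w t i)
    (hsw : ∀ t t', σ t' = σ t → sw t' = sw t)
    (hswitch : ∀ t, W (sw t) (σ t (Fin.castSucc (sw t))) (σ t (sw t).succ) =
      ∑ t' ∈ univ.filter (fun t' => σ t' = σ t), c t' • w t' (sw t))
    (hdead : ∀ π : Fin (N + 1) → m, π 0 = x₀ → π (Fin.last N) = y₀ → (∀ t, σ t ≠ π) →
      ∃ i : Fin N, W i (π (Fin.castSucc i)) (π i.succ) = 0) :
    (∑ π : Fin (N + 1) → m, if π 0 = x₀ ∧ π (Fin.last N) = y₀ then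
        productOp (fun i : Fin N => W i (π (Fin.castSucc i)) (π i.succ)) else 0) =
      ∑ t, c t • productOp (w t) := by
  classical
  rw [← Finset.sum_fiberwise univ σ fun t => c t • productOp (w t)]
  refine Finset.sum_congr rfl fun π _ => ?_
  by_cases hπ : ∃ t, σ t = π
  · obtain ⟨t, rfl⟩ := hπ
    rw [if_pos (hends t)]
    have hW : (fun i : Fin N => W i (σ t (Fin.castSucc i)) (σ t i.succ)) =
        Function.update (w t) (sw t) (∑ t' ∈ univ.filter (fun t' => σ t' = σ t), c t' • w t' (sw t)) := by
      funext i
      by_cases hi : i = sw t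
      · rw [hi, Function.update_self, hswitch]
      · rw [Function.update_of_ne hi, hshared t i hi]
    rw [hW, productOp_update_sum_smul]
    refine Finset.sum_congr rfl fun t' ht' => ?_
    have hσ : σ t' = σ t := (mem_filter.mp ht').2
    have hw : Function.update (w t) (sw t) (w t' (sw t)) = w t' := by
      funext i
      by_cases hi : i = sw t
      · rw [hi, Function.update_self]
      · rw [Function.update_of_ne hi, ← hshared t i hi, ← hshared t' i (by rwa [hsw t t' hσ]), hσ]
    rw [hw]
  · push Not at hπ
    have hempty : univ.filter (fun t => σ t = π) = ∅ :=
      Finset.filter_eq_empty_iff.mpr fun t _ => hπ t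
    rw [hempty, Finset.sum_empty]
    split_ifs with h
    · obtain ⟨i, hi⟩ := hdead π h.1 h.2 hπ
      exact productOp_eq_zero_of_apply_eq_zero (x := i) hi
    · rfl

/-! ### The trie / complementary-suffix structure of §3 leaves no other accepting path -/

omit [Fintype m] in
/-- **No foreign accepting path in a trie / co-trie automaton (FORMAT-qcmps0 §3)** — any letter type, only `≠ 0` is
used. The bond states `σ t b`, `b ≤ sw t`, are the term's TRIE states (`T(w^t[:b])`), those with `sw t < b` its CO-TRIE
states (`C(w^t[b:])`). If no bond state is a trie state of one term and a co-trie state of another (`hdisj`) and every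
edge with a non-zero letter is a TRIE edge (every term in its target comes from its source: a prefix has one parent), a
CO-TRIE edge (every term in its source proceeds to its target: a suffix has one child) or the SWITCH edge of some term
(`hedges`), then (`N ≥ 1`) every path from `x₀` to `y₀` other than the terms' own paths meets a zero letter — hypothesis
(iv) of `sum_paths_productOp_eq_sum_terms` (induction forward along the trie part and backward along the co-trie part
of the path; its switch edge names the term). -/
theorem exists_letter_eq_zero_of_trie {L : Type*} [Zero L] (hN : 0 < N) (W : Fin N → m → m → L) (x₀ y₀ : m)
    (σ : T → Fin (N + 1) → m) (sw : T → Fin N) (hends : ∀ t, σ t 0 = x₀ ∧ σ t (Fin.last N) = y₀)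
    (hdisj : ∀ (b : Fin (N + 1)) (t t' : T), σ t' b = σ t b → (b : ℕ) ≤ sw t → (b : ℕ) ≤ sw t')
    (hedges : ∀ (i : Fin N) (x y : m), W i x y ≠ 0 →
      ((∃ t, σ t i.succ = y ∧ (i : ℕ) + 1 ≤ sw t) ∧
          ∀ t, σ t i.succ = y → (i : ℕ) + 1 ≤ sw t → σ t (Fin.castSucc i) = x) ∨
        ((∃ t, σ t (Fin.castSucc i) = x ∧ (sw t : ℕ) < i) ∧
          ∀ t, σ t (Fin.castSucc i) = x → (sw t : ℕ) < i → σ t i.succ = y) ∨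
        (∃ t, sw t = i ∧ σ t (Fin.castSucc i) = x ∧ σ t i.succ = y)) :
    ∀ π : Fin (N + 1) → m, π 0 = x₀ → π (Fin.last N) = y₀ → (∀ t, σ t ≠ π) →
      ∃ i : Fin N, W i (π (Fin.castSucc i)) (π i.succ) = 0 := by
  intro π h0 hlast hnot
  by_contra hne
  push Not at hne
  -- forward along the trie part: a term found in a trie state of the path agrees with the path up to there
  have stepA : ∀ b : Fin (N + 1), (∃ t, σ t b = π b ∧ (b : ℕ) ≤ sw t) →
      ∀ t, σ t b = π b → (b : ℕ) ≤ sw t → ∀ j : Fin (N + 1), j ≤ b → σ t j = π j := by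
    intro b
    induction b using Fin.induction with
    | zero =>
      intro _ t _ _ j hj
      rw [le_antisymm hj (Fin.zero_le j), (hends t).1, h0]
    | succ i ih =>
      intro _ t ht hb j hj
      rw [Fin.val_succ] at hb
      rcases hedges i _ _ (hne i) with ⟨-, hTT⟩ | ⟨⟨t', ht', hsw'⟩, hCC⟩ | ⟨t', hsw', -, hy'⟩
      · have hprev : σ t (Fin.castSucc i) = π (Fin.castSucc i) := hTT t ht hb
        rcases lt_or_eq_of_le hj with hlt | heq
        · exact ih ⟨t, hprev, by rw [Fin.val_castSucc]; omega⟩ t hprev (by rw [Fin.val_castSucc]; omega) j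
            (Fin.le_castSucc_iff.mpr hlt)
        · rw [heq, ht]
      · have h1 : σ t' i.succ = π i.succ := hCC t' ht' hsw'
        have h2 := hdisj i.succ t t' (by rw [h1, ht]) (by rw [Fin.val_succ]; exact hb)
        rw [Fin.val_succ] at h2
        omega
      · have h2 := hdisj i.succ t t' (by rw [hy', ht]) (by rw [Fin.val_succ]; exact hb)
        rw [Fin.val_succ, hsw'] at h2
        omega
  -- backward along the co-trie part
  have stepB : ∀ b : Fin (N + 1), (∃ t, σ t b = π b ∧ (sw t : ℕ) < b) →
      ∀ t, σ t b = π b → (sw t : ℕ) < b → ∀ j : Fin (N + 1), b ≤ j → σ t j = π j := by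
    intro b
    induction b using Fin.reverseInduction with
    | last =>
      intro _ t _ _ j hj
      rw [le_antisymm (Fin.le_last j) hj, (hends t).2, hlast]
    | cast i ih =>
      intro _ t ht hb j hj
      rw [Fin.val_castSucc] at hb
      rcases hedges i _ _ (hne i) with ⟨⟨t', ht', hsw'⟩, hTT⟩ | ⟨-, hCC⟩ | ⟨t', hsw', hx', -⟩
      · have h1 : σ t' (Fin.castSucc i) = π (Fin.castSucc i) := hTT t' ht' hsw'
        have h2 := hdisj (Fin.castSucc i) t' t (by rw [ht, h1]) (by rw [Fin.val_castSucc]; omega)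
        rw [Fin.val_castSucc] at h2
        omega
      · have hnext : σ t i.succ = π i.succ := hCC t ht hb
        rcases lt_or_eq_of_le hj with hlt | heq
        · exact ih ⟨t, hnext, by rw [Fin.val_succ]; omega⟩ t hnext (by rw [Fin.val_succ]; omega) j
            (Fin.castSucc_lt_iff_succ_le.mp hlt)
        · rw [← heq, ht]
      · have h2 := hdisj (Fin.castSucc i) t' t (by rw [ht, hx']) (by rw [Fin.val_castSucc, hsw'])
        rw [Fin.val_castSucc] at h2
        omega
  -- the START state is a trie state (there is a first edge), the END state is not
  have hT0 : ∃ t, σ t 0 = π 0 ∧ ((0 : Fin (N + 1)) : ℕ) ≤ sw t := by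
    rcases hedges ⟨0, hN⟩ _ _ (hne ⟨0, hN⟩) with ⟨⟨t, -, -⟩, -⟩ | ⟨⟨t, -, hlt⟩, -⟩ | ⟨t, -, -, -⟩
    · exact ⟨t, by rw [(hends t).1, h0], by simp⟩
    · exact absurd hlt (Nat.not_lt_zero _)
    · exact ⟨t, by rw [(hends t).1, h0], by simp⟩
  have hTN : ¬ ∃ t, σ t (Fin.last N) = π (Fin.last N) ∧ ((Fin.last N : Fin (N + 1)) : ℕ) ≤ sw t := by
    rintro ⟨t, -, h⟩
    rw [Fin.val_last] at h
    exact absurd (sw t).isLt (by omega)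
  -- hence the path leaves the trie states somewhere: at that edge it switches, naming a term
  obtain ⟨i, hTi, hnTi⟩ : ∃ i : Fin N, (∃ t, σ t (Fin.castSucc i) = π (Fin.castSucc i) ∧ (i : ℕ) ≤ sw t) ∧
      ¬ ∃ t, σ t i.succ = π i.succ ∧ (i : ℕ) + 1 ≤ sw t := by
    by_contra hcon
    push Not at hcon
    refine hTN (Fin.induction (motive := fun b => ∃ t, σ t b = π b ∧ (b : ℕ) ≤ sw t) hT0 (fun i hi => ?_)
      (Fin.last N))
    rw [Fin.val_castSucc] at hi
    obtain ⟨t, ht⟩ := hcon i hi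
    exact ⟨t, by rw [Fin.val_succ]; exact ht⟩
  rcases hedges i _ _ (hne i) with ⟨hT', -⟩ | ⟨⟨t', ht', hsw'⟩, -⟩ | ⟨t, hswt, hx, hy⟩
  · exact hnTi hT'
  · obtain ⟨t, ht, hle⟩ := hTi
    have h2 := hdisj (Fin.castSucc i) t t' (by rw [ht, ht']) (by rw [Fin.val_castSucc]; exact hle)
    rw [Fin.val_castSucc] at h2
    omega
  · refine hnot t (funext fun j => ?_)
    rcases le_or_gt j (Fin.castSucc i) with hj | hj
    · exact stepA (Fin.castSucc i) ⟨t, hx, by rw [Fin.val_castSucc, hswt]⟩ t hx (by rw [Fin.val_castSucc, hswt])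
        j hj
    · exact stepB i.succ ⟨t, hy, by rw [Fin.val_succ, hswt]; omega⟩ t hy (by rw [Fin.val_succ, hswt]; omega) j
        (Fin.castSucc_lt_iff_succ_le.mp hj)

omit [Fintype m] [DecidableEq m] [Fintype T] in
/-- In a trie / co-trie automaton, terms with the same state path switch at the same site (hypothesis (ii) of
`sum_paths_productOp_eq_sum_terms` is automatic). -/
theorem sw_eq_of_path_eq_of_trie (σ : T → Fin (N + 1) → m) (sw : T → Fin N)
    (hdisj : ∀ (b : Fin (N + 1)) (t t' : T), σ t' b = σ t b → (b : ℕ) ≤ sw t → (b : ℕ) ≤ sw t') :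
    ∀ t t', σ t' = σ t → sw t' = sw t := by
  intro t t' h
  have h1 := hdisj (Fin.castSucc (sw t)) t t' (by rw [h]) (by rw [Fin.val_castSucc])
  have h2 := hdisj (Fin.castSucc (sw t')) t' t (by rw [h]) (by rw [Fin.val_castSucc])
  rw [Fin.val_castSucc] at h1 h2
  exact Fin.ext (by omega)

/-- **Soundness of the §3 automaton, structural form — the MPO's word products ARE `Σ_t c_t ⨂_i w^t_i`.** The
operator whose configuration matrix elements are the word products `(W₀[κ₀,κ'₀] ⋯ W_{N-1}[κ_{N-1},κ'_{N-1}])[x₀, y₀]`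
(site tensors `O i s s' = (x, y) ↦ W i x y s s'`; the object `Rows/SweepContraction.lean` sweeps, the `hO`-shape of
`Rows/MPSUpperBound.lean`) equals `Σ_t c_t ⨂_i w^t_i` whenever the MPO is organised over the term list as §3 prescribes
(`hshared`, `hswitch`, `hdisj`, `hedges` as above; `N ≥ 1`). Letters in `ℂ^{q×q}`, every bond dimension and policy. -/
theorem of_wordProducts_eq_sum_terms_of_trie (hN : 0 < N) (W : Fin N → m → m → Matrix (Fin q) (Fin q) ℂ)
    (x₀ y₀ : m) (c : T → ℂ) (w : T → Fin N → Matrix (Fin q) (Fin q) ℂ) (σ : T → Fin (N + 1) → m)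
    (sw : T → Fin N) (hends : ∀ t, σ t 0 = x₀ ∧ σ t (Fin.last N) = y₀)
    (hshared : ∀ t (i : Fin N), i ≠ sw t → W i (σ t (Fin.castSucc i)) (σ t i.succ) = w t i)
    (hswitch : ∀ t, W (sw t) (σ t (Fin.castSucc (sw t))) (σ t (sw t).succ) =
      ∑ t' ∈ univ.filter (fun t' => σ t' = σ t), c t' • w t' (sw t))
    (hdisj : ∀ (b : Fin (N + 1)) (t t' : T), σ t' b = σ t b → (b : ℕ) ≤ sw t → (b : ℕ) ≤ sw t')
    (hedges : ∀ (i : Fin N) (x y : m), W i x y ≠ 0 →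
      ((∃ t, σ t i.succ = y ∧ (i : ℕ) + 1 ≤ sw t) ∧
          ∀ t, σ t i.succ = y → (i : ℕ) + 1 ≤ sw t → σ t (Fin.castSucc i) = x) ∨
        ((∃ t, σ t (Fin.castSucc i) = x ∧ (sw t : ℕ) < i) ∧
          ∀ t, σ t (Fin.castSucc i) = x → (sw t : ℕ) < i → σ t i.succ = y) ∨
        (∃ t, sw t = i ∧ σ t (Fin.castSucc i) = x ∧ σ t i.succ = y)) :
    (Matrix.of fun κ κ' : TensorIndex (Fin N) q =>
        (List.ofFn fun i : Fin N => (Matrix.of fun x y : m => W i x y (κ i) (κ' i))).prod x₀ y₀) =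
      ∑ t, c t • productOp (w t) := by
  rw [of_ofFn_prod_apply_eq_sum_paths_productOp]
  exact sum_paths_productOp_eq_sum_terms W x₀ y₀ c w σ sw hends hshared (sw_eq_of_path_eq_of_trie σ sw hdisj)
    hswitch (exists_letter_eq_zero_of_trie hN W x₀ y₀ σ sw hends hdisj hedges)

end Automaton

/-! ## The exact MPO represents `H`: the hypothesis `hO` of `Rows/MPSUpperBound.lean` from the automaton's structure -/

section Represents

variable {m : Type*} [Fintype m] [DecidableEq m] {T : Type*} [Fintype T] {k : ℕ}
  {n : Type*} [Fintype n] [DecidableEq n]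

/-- `(Σ_i c_i A_i)` read in `ℂ` is `Σ_i c_i (A_i read in ℂ)` (real scalars, real letters). -/
private theorem map_ofReal_sum_smul {ι : Type*} (s : Finset ι) (c : ι → ℝ) (A : ι → Matrix (Fin 4) (Fin 4) ℝ) :
    (∑ i ∈ s, c i • A i).map ((↑) : ℝ → ℂ) = ∑ i ∈ s, (c i : ℂ) • (A i).map ((↑) : ℝ → ℂ) := by
  ext a b
  simp [Matrix.map_apply, Matrix.sum_apply, Matrix.smul_apply, Complex.ofReal_sum, Complex.ofReal_mul]

/-- **`hO` from structure (FORMAT-qcmps0 §3 ⇒ the OPERATOR hypothesis of `Rows/MPSUpperBound.lean`).** Let `H` be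
presented by a finite REAL term list in the site-major occupation basis, `toSpin H = Σ_t c_t • ⨂_i w^t_i` (for `H_F`:
`toSpin_molecularHamiltonian_eq_sum_productOp` — integrals times words in `1, P, c_σ, c†_σ` and their products), and
let a real MPO (`W i x y` on one bond-state type `m`, START `x₀`, END `y₀`, `k ≥ 1`) be organised over that list as §3
prescribes (`hshared`, `hswitch`, `hdisj`, `hedges`). Then its word products are the configuration matrix elements of
`H` — LITERALLY the hypothesis `hO` (site tensors `O i s s' = (x, y) ↦ W i x y s s'`) under which
`Rows/MPSUpperBound.lean` turns the swept numbers of an MPS into `UpperCertificate` / `UpperRow`. -/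
theorem toSpin_eq_wordProducts_of_trie (hk : 0 < k) (H : Matrix (Finset (Orb (Fin k))) (Finset (Orb (Fin k))) ℂ)
    (c : T → ℝ) (w : T → Fin k → Matrix (Fin 4) (Fin 4) ℝ)
    (hH : toSpin H = ∑ t, (c t : ℂ) • productOp (fun i : Fin k => (w t i).map ((↑) : ℝ → ℂ)))
    (W : ℕ → m → m → Matrix (Fin 4) (Fin 4) ℝ) (x₀ y₀ : m) (σ : T → Fin (k + 1) → m) (sw : T → Fin k)
    (hends : ∀ t, σ t 0 = x₀ ∧ σ t (Fin.last k) = y₀)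
    (hshared : ∀ t (i : Fin k), i ≠ sw t → W i (σ t (Fin.castSucc i)) (σ t i.succ) = w t i)
    (hswitch : ∀ t, W (sw t) (σ t (Fin.castSucc (sw t))) (σ t (sw t).succ) =
      ∑ t' ∈ univ.filter (fun t' => σ t' = σ t), c t' • w t' (sw t))
    (hdisj : ∀ (b : Fin (k + 1)) (t t' : T), σ t' b = σ t b → (b : ℕ) ≤ sw t → (b : ℕ) ≤ sw t')
    (hedges : ∀ (i : Fin k) (x y : m), W i x y ≠ 0 →
      ((∃ t, σ t i.succ = y ∧ (i : ℕ) + 1 ≤ sw t) ∧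
          ∀ t, σ t i.succ = y → (i : ℕ) + 1 ≤ sw t → σ t (Fin.castSucc i) = x) ∨
        ((∃ t, σ t (Fin.castSucc i) = x ∧ (sw t : ℕ) < i) ∧
          ∀ t, σ t (Fin.castSucc i) = x → (sw t : ℕ) < i → σ t i.succ = y) ∨
        (∃ t, sw t = i ∧ σ t (Fin.castSucc i) = x ∧ σ t i.succ = y)) :
    toSpin H = Matrix.of fun κ κ' : TensorIndex (Fin k) 4 =>
      (((List.ofFn fun i : Fin k => (Matrix.of fun x y : m => W i x y (κ i) (κ' i))).prod x₀ y₀ : ℝ) : ℂ) := by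
  refine toSpin_eq_of_wordProducts_of_eq_sum_paths H W x₀ y₀ ?_
  rw [hH]
  refine (sum_paths_productOp_eq_sum_terms (fun (i : Fin k) x y => (W i x y).map ((↑) : ℝ → ℂ)) x₀ y₀
    (fun t => (c t : ℂ)) (fun t i => (w t i).map ((↑) : ℝ → ℂ)) σ sw hends ?_
    (sw_eq_of_path_eq_of_trie σ sw hdisj) ?_ ?_).symm
  · intro t i hi
    simp only [hshared t i hi]
  · intro t
    simp only [hswitch t, map_ofReal_sum_smul]
  · intro π h0 hl hπ
    obtain ⟨i, hi⟩ :=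
      exists_letter_eq_zero_of_trie hk (fun (i : Fin k) x y => W i x y) x₀ y₀ σ sw hends hdisj hedges π h0 hl hπ
    exact ⟨i, by simp only [hi, Matrix.map_zero _ Complex.ofReal_zero]⟩

/-- **END FORM — the MPS upper row with the operator hypothesis discharged to the builder's structure
(FORMAT-qcmps0 §0–§4, all of it in the kernel).** For a symmetric model `F` presented as a real term list
`H_F = Σ_t c_t ⨂_i w^t_i`: a trie / co-trie MPO over that list (as in `toSpin_eq_wordProducts_of_trie`), an MPS state
file passing the §1.2 sector checks (charge-labelled blocks), the two exact sweeps WITH THAT MPO and their enclosures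
with the value rule prove `UpperRow F a b hi`. Compared with `upperRow_of_mps_charges_sweeps` the global hypothesis
`hO` ("the MPO represents `H_F`") is replaced by per-edge facts about the emitted tensors (`hshared`, `hswitch`,
`hdisj`, `hedges`) and the term-list presentation `hH`. Instance data (the letters, labels, block entries and the
enclosure arithmetic of a given file) stay with the readers, as for every certificate class of the cell. -/
theorem upperRow_of_mps_trie_charges_sweeps (hk : 0 < k) {F : Model k} (hF : F.IsSymmetric) {a b : ℕ}
    (c : T → ℝ) (wt : T → Fin k → Matrix (Fin 4) (Fin 4) ℝ)
    (hH : toSpin F.hamiltonian = ∑ t, (c t : ℂ) • productOp (fun i : Fin k => (wt t i).map ((↑) : ℝ → ℂ)))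
    (W : ℕ → m → m → Matrix (Fin 4) (Fin 4) ℝ) (x₀ y₀ : m) (σ : T → Fin (k + 1) → m) (sw : T → Fin k)
    (hends : ∀ t, σ t 0 = x₀ ∧ σ t (Fin.last k) = y₀)
    (hshared : ∀ t (i : Fin k), i ≠ sw t → W i (σ t (Fin.castSucc i)) (σ t i.succ) = wt t i)
    (hswitch : ∀ t, W (sw t) (σ t (Fin.castSucc (sw t))) (σ t (sw t).succ) =
      ∑ t' ∈ univ.filter (fun t' => σ t' = σ t), c t' • wt t' (sw t))
    (hdisj : ∀ (b : Fin (k + 1)) (t t' : T), σ t' b = σ t b → (b : ℕ) ≤ sw t → (b : ℕ) ≤ sw t')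
    (hedges : ∀ (i : Fin k) (x y : m), W i x y ≠ 0 →
      ((∃ t, σ t i.succ = y ∧ (i : ℕ) + 1 ≤ sw t) ∧
          ∀ t, σ t i.succ = y → (i : ℕ) + 1 ≤ sw t → σ t (Fin.castSucc i) = x) ∨
        ((∃ t, σ t (Fin.castSucc i) = x ∧ (sw t : ℕ) < i) ∧
          ∀ t, σ t (Fin.castSucc i) = x → (sw t : ℕ) < i → σ t i.succ = y) ∨
        (∃ t, sw t = i ∧ σ t (Fin.castSucc i) = x ∧ σ t i.succ = y))
    (A : ℕ → Fin 4 → Matrix n n ℝ) (u w : n → ℝ) (ch : Fin (k + 1) → n → ℕ × ℕ)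
    (hA : ∀ (i : Fin k) (s : Fin 4) (x y : n), A i s x y ≠ 0 → ch i.succ y = ch (Fin.castSucc i) x +
      (if (0 : Fin 2) ∈ siteOcc s then 1 else 0, if (1 : Fin 2) ∈ siteOcc s then 1 else 0))
    (hu : ∀ x, u x ≠ 0 → ch 0 x = (0, 0)) (hw : ∀ y, w y ≠ 0 → ch (Fin.last k) y = (a, b))
    (L : ℕ → m → Matrix n n ℝ)
    (hL : ∀ j y, L (j + 1) y = ∑ x, ∑ s, ∑ s', W j x y s s' • ((A j s)ᵀ * L j x * A j s'))
    (hL0 : ∀ x, L 0 x = if x = x₀ then vecMulVec u u else 0)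
    (G : ℕ → Matrix n n ℝ) (hG : ∀ j, G (j + 1) = ∑ s, (A j s)ᵀ * G j * A j s) (hG0 : G 0 = vecMulVec u u)
    {hhi nlo nhi : ℝ} (hh : w ⬝ᵥ (L k y₀ *ᵥ w) ≤ hhi) (hlo : nlo ≤ w ⬝ᵥ (G k *ᵥ w))
    (hnhi : w ⬝ᵥ (G k *ᵥ w) ≤ nhi) (hpos : 0 < nlo) {hi : ℚ} (hE : max (hhi / nlo) (hhi / nhi) ≤ ((hi : ℚ) : ℝ)) :
    UpperRow F a b hi :=
  upperRow_of_mps_charges_sweeps hF A u w ch hA hu hw (fun j s s' => Matrix.of fun x y : m => W j x y s s') x₀ y₀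
    (toSpin_eq_wordProducts_of_trie hk F.hamiltonian c wt hH W x₀ y₀ σ sw hends hshared hswitch hdisj hedges)
    L hL hL0 G hG hG0 hh hlo hnhi hpos hE

end Represents

end Summit.Ventures.CertifiedQuantumChemistry

end
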